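import Summits.KontsevichZagierPeriods.KontsevichZagierPeriods.Theorems.TerasomaMultiplicationMultiplicationAccessibleCornerGraphRepsGen
import Summits.KontsevichZagierPeriods.KontsevichZagierPeriods.Theorems.TerasomaMultiplicationMultiplicationAccessibleCornerFieldGen
import Summits.KontsevichZagierPeriods.KontsevichZagierPeriods.Theorems.TerasomaMultiplicationMultiplicationAccessibleCornerStokesYFibre
import Summits.KontsevichZagierPeriods.KontsevichZagierPeriods.Theorems.TerasomaMultiplicationMultiplicationAccessibleCornerStokesTheta1Facts

/-!
# `MultiplicationAccessible` (stmt-KontsevichZagierPeriods-12305), line `shifted-family-prime-sieve`: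
slice calculus for the `θ_i`-derivative bound of the corner Stokes, all `p = n + 2` (auxiliary file)

Along a `θ_i`-slice `a ↦ update u (castSucc i) a` of the chart domain `U` only the barycentric weights
`Θ₀ = 1 − Σθ` and `Θ_{i+1} = θ_i` move (with derivatives `−1`, `+1`), hence only the box coordinates
`t₀ = 1 − yΘ₀`, `t_{i+1} = 1 − yθ_i` move (derivatives `+y`, `−y`). This file records the generic
one-variable estimates used to bound `∂_{θ_i}` of the Stokes component
`Vθ i = P·θ_i·(Σ_j Θ_j (M_{i+1} − M_j))/y`: products of factors in `[0,1]` with bounded derivatives,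
Bernoulli's inequality for the monomials `M_j` (`1 − M_j ≤ x·y`), the compensations `M_j ≤ t₀ t_{i+1}`
(every box coordinate occurs in every `M_j` with exponent `≥ 1`) and the slice derivatives of `Θ`, `T`.
References: Kontsevich–Zagier 2001 §1.2 rule (3).
-/

noncomputable section

open MeasureTheory Set Real
open scoped BigOperators Topology
open Literature.NumberTheory.Transcendental
open Literature.NumberTheory.Transcendental.KZ

namespace Summit.KontsevichZagierPeriods.TerasomaMultiplication.MultiplicationAccessible

namespace CornerThetaDeriv

variable {n : ℕ}

/-! ### Generic one-variable estimates -/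

/-- `1 − ∏ g ≤ Σ (1 − g)` for factors in `[0, 1]`. [folklore] -/
theorem one_sub_prod_le_sum {ι : Type*} (s : Finset ι) (g : ι → ℝ)
    (hg : ∀ l ∈ s, 0 ≤ g l ∧ g l ≤ 1) : 1 - ∏ l ∈ s, g l ≤ ∑ l ∈ s, (1 - g l) := by
  classical
  induction s using Finset.induction_on with
  | empty => simp
  | insert a s ha ih =>
    rw [Finset.prod_insert ha, Finset.sum_insert ha]
    have hga := hg a (Finset.mem_insert_self a s)
    have hs : ∀ l ∈ s, 0 ≤ g l ∧ g l ≤ 1 := fun l hl => hg l (Finset.mem_insert_of_mem hl)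
    have hP0 : 0 ≤ ∏ l ∈ s, g l := Finset.prod_nonneg fun l hl => (hs l hl).1
    have hP1 : ∏ l ∈ s, g l ≤ 1 := Finset.prod_le_one (fun l hl => (hs l hl).1) fun l hl => (hs l hl).2
    have := ih hs
    nlinarith [mul_nonneg (sub_nonneg.mpr hga.2) (sub_nonneg.mpr hP1)]

/-- A product of functions with values in `[0, 1]` and derivatives bounded by `G` has derivative
bounded by `#s · G`. [folklore] -/
theorem exists_hasDerivAt_prod_le {ι : Type*} (s : Finset ι) (f : ι → ℝ → ℝ) (f' : ι → ℝ) (a G : ℝ)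
    (hf : ∀ l ∈ s, HasDerivAt (f l) (f' l) a) (h01 : ∀ l ∈ s, 0 ≤ f l a ∧ f l a ≤ 1)
    (hG : ∀ l ∈ s, |f' l| ≤ G) :
    ∃ D, HasDerivAt (fun b => ∏ l ∈ s, f l b) D a ∧ |D| ≤ s.card * G := by
  classical
  have h := HasDerivAt.finsetProd hf
  have h' : HasDerivAt (fun b => ∏ l ∈ s, f l b) (∑ i ∈ s, (∏ j ∈ s.erase i, f j a) • f' i) a :=
    h.congr_of_eventuallyEq (Filter.Eventually.of_forall fun b => by simp [Finset.prod_apply])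
  refine ⟨_, h', ?_⟩
  calc |∑ l ∈ s, (∏ j ∈ s.erase l, f j a) • f' l| ≤ ∑ l ∈ s, |(∏ j ∈ s.erase l, f j a) • f' l| :=
        Finset.abs_sum_le_sum_abs _ _
    _ ≤ ∑ _l ∈ s, G := Finset.sum_le_sum fun l hl => by
        rw [smul_eq_mul, abs_mul, abs_of_nonneg (Finset.prod_nonneg fun j hj => (h01 j (Finset.mem_of_mem_erase hj)).1)]
        calc (∏ j ∈ s.erase l, f j a) * |f' l| ≤ 1 * G :=
              mul_le_mul (Finset.prod_le_one (fun j hj => (h01 j (Finset.mem_of_mem_erase hj)).1)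
                fun j hj => (h01 j (Finset.mem_of_mem_erase hj)).2) (hG l hl) (abs_nonneg _) zero_le_one
          _ = G := one_mul G
    _ = s.card * G := by rw [Finset.sum_const, nsmul_eq_mul]

/-- A real power `T^e` (`1 ≤ e ≤ emax`) of a function with values in `(0, 1]` and `|T'| ≤ Y`: value in
`[0,1]`, derivative `T'·e·T^(e−1)` bounded by `emax · Y`. [folklore] -/
theorem hasDerivAt_rpow_factor {T : ℝ → ℝ} {T' a e emax Y : ℝ} (hT : HasDerivAt T T' a)
    (h0 : 0 < T a) (h1 : T a ≤ 1) (he : 1 ≤ e) (hex : e ≤ emax) (hY : |T'| ≤ Y) :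
    HasDerivAt (fun b => T b ^ e) (T' * e * T a ^ (e - 1)) a ∧
      (0 ≤ T a ^ e ∧ T a ^ e ≤ 1) ∧ |T' * e * T a ^ (e - 1)| ≤ emax * Y := by
  refine ⟨hT.rpow_const (Or.inl h0.ne'), ⟨rpow_nonneg h0.le _, rpow_le_one h0.le h1 (by linarith)⟩, ?_⟩
  have hp1 : T a ^ (e - 1) ≤ 1 := rpow_le_one h0.le h1 (by linarith)
  have hp0 : 0 ≤ T a ^ (e - 1) := rpow_nonneg h0.le _
  rw [abs_mul, abs_mul, abs_of_nonneg (by linarith : (0:ℝ) ≤ e), abs_of_nonneg hp0]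
  have hY0 : 0 ≤ Y := (abs_nonneg _).trans hY
  have hemax : 0 ≤ emax := by linarith
  calc |T'| * e * T a ^ (e - 1) ≤ Y * emax * 1 :=
        mul_le_mul (mul_le_mul hY hex (by linarith) hY0) hp1 hp0 (mul_nonneg hY0 hemax)
    _ = emax * Y := by ring

/-! ### The `θ_i`-slice of the chart: derivatives of `Θ` and `T` -/

/-- Coordinates of the updated point: the `y`-coordinate is unchanged. [folklore] -/
theorem update_last (u : Fin (n + 2) → ℝ) (i : Fin (n + 1)) (a : ℝ) :
    Function.update u (Fin.castSucc i) a (Fin.last (n + 1)) = u (Fin.last (n + 1)) :=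
  Function.update_of_ne (Fin.castSucc_lt_last i).ne' _ _

/-- Coordinates of the updated point: `θ_j` becomes `a` for `j = i` and is unchanged otherwise. [folklore] -/
theorem update_castSucc (u : Fin (n + 2) → ℝ) (i j : Fin (n + 1)) (a : ℝ) :
    Function.update u (Fin.castSucc i) a (Fin.castSucc j) = if j = i then a else u (Fin.castSucc j) := by
  by_cases h : j = i
  · subst h; simp
  · rw [if_neg h, Function.update_of_ne (fun h' => h (Fin.castSucc_injective _ h'))]

/-- The slice derivative of `Σ_j θ_j` is `1`. [folklore] -/
theorem hasDerivAt_sum_update (u : Fin (n + 2) → ℝ) (i : Fin (n + 1)) (a₀ : ℝ) :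
    HasDerivAt (fun a => ∑ j : Fin (n + 1), Function.update u (Fin.castSucc i) a (Fin.castSucc j)) 1 a₀ := by
  have h : ∀ a, ∑ j : Fin (n + 1), Function.update u (Fin.castSucc i) a (Fin.castSucc j) =
      a + ∑ j ∈ Finset.univ.erase i, u (Fin.castSucc j) := by
    intro a
    rw [← Finset.add_sum_erase Finset.univ _ (Finset.mem_univ i)]
    simp only [update_castSucc, if_true]
    congr 1
    exact Finset.sum_congr rfl fun j hj => by rw [if_neg (Finset.ne_of_mem_erase hj)]
  simp_rw [h]
  exact (hasDerivAt_id a₀).add_const _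

/-- **Slice derivatives of the barycentric weights**: `∂Θ₀ = −1`, `∂Θ_{i+1} = 1`, `∂Θ_l = 0`
otherwise. [folklore] -/
theorem hasDerivAt_Theta {Θ : (Fin (n + 2) → ℝ) → Fin (n + 2) → ℝ}
    (hΘ0 : ∀ u, Θ u 0 = 1 - ∑ i : Fin (n + 1), u (Fin.castSucc i))
    (hΘs : ∀ u (i : Fin (n + 1)), Θ u i.succ = u (Fin.castSucc i))
    (u : Fin (n + 2) → ℝ) (i : Fin (n + 1)) (a₀ : ℝ) (l : Fin (n + 2)) :
    HasDerivAt (fun a => Θ (Function.update u (Fin.castSucc i) a) l)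
      (Fin.cases (-1) (fun j => if j = i then 1 else 0) l) a₀ := by
  refine Fin.cases ?_ (fun j => ?_) l
  · simp only [hΘ0, Fin.cases_zero]
    exact (hasDerivAt_sum_update u i a₀).const_sub 1 |>.congr_deriv (by ring)
  · simp only [hΘs, Fin.cases_succ, update_castSucc]
    by_cases h : j = i
    · simp only [h, if_true]; exact hasDerivAt_id a₀
    · simp only [h, if_false]; exact hasDerivAt_const _ _

/-- **Slice derivatives of the box coordinates**: `∂t_l = −y·∂Θ_l`. [folklore] -/
theorem hasDerivAt_T {Θ T : (Fin (n + 2) → ℝ) → Fin (n + 2) → ℝ}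
    (hΘ0 : ∀ u, Θ u 0 = 1 - ∑ i : Fin (n + 1), u (Fin.castSucc i))
    (hΘs : ∀ u (i : Fin (n + 1)), Θ u i.succ = u (Fin.castSucc i))
    (hT : ∀ u k, T u k = 1 - u (Fin.last (n + 1)) * Θ u k)
    (u : Fin (n + 2) → ℝ) (i : Fin (n + 1)) (a₀ : ℝ) (l : Fin (n + 2)) :
    HasDerivAt (fun a => T (Function.update u (Fin.castSucc i) a) l)
      (-(u (Fin.last (n + 1)) * Fin.cases (-1) (fun j => if j = i then 1 else 0) l)) a₀ := by
  simp only [hT, update_last]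
  exact ((hasDerivAt_Theta hΘ0 hΘs u i a₀ l).const_mul _).const_sub 1 |>.congr_deriv (by ring)

/-- The slice derivatives of the box coordinates are bounded by `y`. [folklore] -/
theorem abs_dT_le (y : ℝ) (hy : 0 ≤ y) (i : Fin (n + 1)) (l : Fin (n + 2)) :
    |(-(y * Fin.cases (-1) (fun j => if j = i then 1 else 0) l))| ≤ y := by
  refine Fin.cases ?_ (fun j => ?_) l
  · simp [abs_of_nonneg hy]
  · by_cases h : j = i
    · simp [h, abs_of_nonneg hy]
    · simp [h, hy]

/-- Off the two moving indices the box coordinates are constant along the slice. [folklore] -/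
theorem T_update_of_ne {Θ T : (Fin (n + 2) → ℝ) → Fin (n + 2) → ℝ}
    (hΘs : ∀ u (i : Fin (n + 1)), Θ u i.succ = u (Fin.castSucc i))
    (hT : ∀ u k, T u k = 1 - u (Fin.last (n + 1)) * Θ u k)
    (u : Fin (n + 2) → ℝ) (i : Fin (n + 1)) (a : ℝ) {l : Fin (n + 2)} (h0 : l ≠ 0) (hi : l ≠ i.succ) :
    T (Function.update u (Fin.castSucc i) a) l = T u l := by
  obtain ⟨j, rfl⟩ := Fin.exists_succ_eq.mpr h0
  have hj : j ≠ i := fun h => hi (by rw [h])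
  rw [hT, hT, update_last, hΘs, hΘs, update_castSucc, if_neg hj]

/-- **The box product along the slice** factors as `t₀(a) · t_{i+1}(a) · R` with `R` the (constant)
product of the other box coordinates. [folklore] -/
theorem prod_T_update {Θ T : (Fin (n + 2) → ℝ) → Fin (n + 2) → ℝ}
    (hΘs : ∀ u (i : Fin (n + 1)), Θ u i.succ = u (Fin.castSucc i))
    (hT : ∀ u k, T u k = 1 - u (Fin.last (n + 1)) * Θ u k)
    (u : Fin (n + 2) → ℝ) (i : Fin (n + 1)) (a : ℝ) :
    ∏ l, T (Function.update u (Fin.castSucc i) a) l =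
      T (Function.update u (Fin.castSucc i) a) 0 * T (Function.update u (Fin.castSucc i) a) i.succ *
        ∏ l ∈ (Finset.univ.erase 0).erase i.succ, T u l := by
  have hmem : i.succ ∈ Finset.univ.erase (0 : Fin (n + 2)) :=
    Finset.mem_erase.mpr ⟨Fin.succ_ne_zero i, Finset.mem_univ _⟩
  rw [← Finset.mul_prod_erase Finset.univ _ (Finset.mem_univ (0 : Fin (n + 2))),
    ← Finset.mul_prod_erase _ _ hmem, mul_assoc]
  congr 2
  refine Finset.prod_congr rfl fun l hl => ?_
  have h1 : l ≠ i.succ := Finset.ne_of_mem_erase hl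
  have h2 : l ≠ 0 := Finset.ne_of_mem_erase (Finset.mem_of_mem_erase hl)
  exact T_update_of_ne hΘs hT u i a h2 h1

/-- The constant factor `R` of the box product is in `(0, 1]` on the chart domain. [folklore] -/
theorem R_mem {Θ T : (Fin (n + 2) → ℝ) → Fin (n + 2) → ℝ}
    (hΘ0 : ∀ u, Θ u 0 = 1 - ∑ i : Fin (n + 1), u (Fin.castSucc i))
    (hΘs : ∀ u (i : Fin (n + 1)), Θ u i.succ = u (Fin.castSucc i))
    (hT : ∀ u k, T u k = 1 - u (Fin.last (n + 1)) * Θ u k) {u : Fin (n + 2) → ℝ}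
    (hu : u ∈ {u : Fin (n + 2) → ℝ | (∀ i : Fin (n + 1), 0 < u (Fin.castSucc i)) ∧ ∑ i : Fin (n + 1), u (Fin.castSucc i) < 1 ∧ 0 < u (Fin.last (n + 1)) ∧ u (Fin.last (n + 1)) * (1 - ∑ i : Fin (n + 1), u (Fin.castSucc i)) < 1 ∧ ∀ i : Fin (n + 1), u (Fin.last (n + 1)) * u (Fin.castSucc i) < 1})
    (i : Fin (n + 1)) :
    0 < ∏ l ∈ (Finset.univ.erase 0).erase i.succ, T u l ∧ ∏ l ∈ (Finset.univ.erase 0).erase i.succ, T u l ≤ 1 := by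
  have ht := fun k => (CornerGraphGen.T_mem hΘ0 hΘs hT hu k).2
  exact ⟨Finset.prod_pos fun l _ => (ht l).1,
    Finset.prod_le_one (fun l _ => (ht l).1.le) fun l _ => (ht l).2.le⟩

/-- **Basic bounds on the chart domain**: `y ∈ (0, p)`, `Θ_l ∈ (0, 1)`, `t_l ∈ (0, 1)`, `Z ∈ (0, 1)`
and `1 − Z ≥ y/p`. [folklore] -/
theorem basic {Θ T : (Fin (n + 2) → ℝ) → Fin (n + 2) → ℝ} {Z : (Fin (n + 2) → ℝ) → ℝ}
    (hΘ0 : ∀ u, Θ u 0 = 1 - ∑ i : Fin (n + 1), u (Fin.castSucc i))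
    (hΘs : ∀ u (i : Fin (n + 1)), Θ u i.succ = u (Fin.castSucc i))
    (hT : ∀ u k, T u k = 1 - u (Fin.last (n + 1)) * Θ u k)
    (hZ : ∀ u, Z u = (∏ k, T u k) ^ (1 / ((n:ℝ) + 2))) {u : Fin (n + 2) → ℝ}
    (hu : u ∈ {u : Fin (n + 2) → ℝ | (∀ i : Fin (n + 1), 0 < u (Fin.castSucc i)) ∧ ∑ i : Fin (n + 1), u (Fin.castSucc i) < 1 ∧ 0 < u (Fin.last (n + 1)) ∧ u (Fin.last (n + 1)) * (1 - ∑ i : Fin (n + 1), u (Fin.castSucc i)) < 1 ∧ ∀ i : Fin (n + 1), u (Fin.last (n + 1)) * u (Fin.castSucc i) < 1}) :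
    (0 < u (Fin.last (n + 1)) ∧ u (Fin.last (n + 1)) < (n:ℝ) + 2) ∧
      (∀ l, 0 < Θ u l ∧ Θ u l < 1) ∧ (∀ l, 0 < T u l ∧ T u l < 1) ∧
      (0 < Z u ∧ Z u < 1) ∧ u (Fin.last (n + 1)) / ((n:ℝ) + 2) ≤ 1 - Z u := by
  have hTm := fun k => CornerGraphGen.T_mem hΘ0 hΘs hT hu k
  have hZle := CornerGraphGen.Z_le hΘ0 hΘs hT hZ hu
  obtain ⟨hpos, hsum, hy, h0, hi⟩ := hu
  have hp : (0:ℝ) < (n:ℝ) + 2 := by positivity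
  have hP0 : 0 < ∏ k, T u k := Finset.prod_pos fun k _ => (hTm k).2.1
  have hP1 : ∏ k, T u k < 1 := by
    rw [Fin.prod_univ_succ]
    calc T u 0 * ∏ l : Fin (n + 1), T u l.succ ≤ T u 0 * 1 := by
          gcongr
          · exact (hTm 0).2.1.le
          · exact Finset.prod_le_one (fun l _ => (hTm _).2.1.le) fun l _ => (hTm _).2.2.le
      _ < 1 := by rw [mul_one]; exact (hTm 0).2.2
  have hZ0 : 0 < Z u := by rw [hZ]; exact rpow_pos_of_pos hP0 _
  have hZ1 : Z u < 1 := by rw [hZ]; exact rpow_lt_one hP0.le hP1 (by positivity)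
  have hΘ1 : ∀ l, Θ u l < 1 := by
    intro l
    refine Fin.cases ?_ (fun j => ?_) l
    · rw [hΘ0]
      have : 0 < ∑ i : Fin (n + 1), u (Fin.castSucc i) :=
        Finset.sum_pos (fun i _ => hpos i) Finset.univ_nonempty
      linarith
    · rw [hΘs]
      have : u (Fin.castSucc j) ≤ ∑ i : Fin (n + 1), u (Fin.castSucc i) :=
        Finset.single_le_sum (f := fun i => u (Fin.castSucc i)) (fun i _ => (hpos i).le) (Finset.mem_univ j)
      linarith
  refine ⟨⟨hy, ?_⟩, fun l => ⟨(hTm l).1.1, hΘ1 l⟩, fun l => (hTm l).2, ⟨hZ0, hZ1⟩, by linarith⟩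
  have h1 : u (Fin.last (n + 1)) / ((n:ℝ) + 2) < 1 := by linarith
  rwa [div_lt_one hp] at h1

/-- Sum version of the cyclic reindexing: `Σ_l f (j + l) = Σ_l f l`. [folklore] -/
theorem sum_add_left (f : Fin (n + 2) → ℝ) (j : Fin (n + 2)) : ∑ l, f (j + l) = ∑ l, f l :=
  Fintype.sum_equiv (Equiv.addLeft j) _ _ fun _ => rfl

/-- The cyclic monomial `M_j` as ONE product over `Fin (n+2)`: `M u j = ∏_l t_{j+l}^(e l)` with
`e 0 = x`, `e (m+1) = x + (m+1)/p − 1`. [folklore] -/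
theorem M_eq_prod (x : ℚ) {T M : (Fin (n + 2) → ℝ) → Fin (n + 2) → ℝ}
    (hM : ∀ u k, M u k = (T u k) ^ (x:ℝ) * ∏ j : Fin (n + 1), (T u (k + j.succ)) ^ ((x:ℝ) + (((j:ℕ):ℝ) + 1) / ((n:ℝ) + 2) - 1))
    (u : Fin (n + 2) → ℝ) (j : Fin (n + 2)) :
    M u j = ∏ l : Fin (n + 2), (T u (j + l)) ^
      (Fin.cases (x:ℝ) (fun m : Fin (n + 1) => (x:ℝ) + (((m:ℕ):ℝ) + 1) / ((n:ℝ) + 2) - 1) l : ℝ) := by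
  rw [hM]
  conv_rhs => rw [Fin.prod_univ_succ]
  simp only [Fin.cases_zero, Fin.cases_succ, add_zero]

/-- The exponents of the cyclic monomials lie in `[1, x]` (`x ≥ 2`). [folklore] -/
theorem exponent_mem {x : ℚ} (hx : 2 ≤ x) (l : Fin (n + 2)) :
    1 ≤ (Fin.cases (x:ℝ) (fun m : Fin (n + 1) => (x:ℝ) + (((m:ℕ):ℝ) + 1) / ((n:ℝ) + 2) - 1) l : ℝ) ∧
      (Fin.cases (x:ℝ) (fun m : Fin (n + 1) => (x:ℝ) + (((m:ℕ):ℝ) + 1) / ((n:ℝ) + 2) - 1) l : ℝ) ≤ x := by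
  have hx' : (2:ℝ) ≤ x := by exact_mod_cast hx
  refine Fin.cases ?_ (fun m => ?_) l
  · simp only [Fin.cases_zero]
    exact ⟨by linarith, le_rfl⟩
  · simp only [Fin.cases_succ]
    have hm : ((m:ℕ):ℝ) + 1 ≤ (n:ℝ) + 1 := by
      have := m.isLt
      exact_mod_cast this
    have hp : (0:ℝ) < (n:ℝ) + 2 := by positivity
    have h1 : (((m:ℕ):ℝ) + 1) / ((n:ℝ) + 2) ≤ 1 := by
      rw [div_le_one hp]; linarith
    have h0 : 0 ≤ (((m:ℕ):ℝ) + 1) / ((n:ℝ) + 2) := by positivity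
    exact ⟨by linarith, by linarith⟩

/-- **Facts about the cyclic monomials on the chart domain** (`x ≥ 2`): `M_j ∈ [0, 1]`,
`M_j ≤ t₀ · t_{i+1}`, `1 − M_j ≤ x·y`, and the slice derivative of `M_j` exists with
`|∂M_j| ≤ p·x·y`. [folklore] -/
theorem M_facts {x : ℚ} (hx : 2 ≤ x) {Θ T M : (Fin (n + 2) → ℝ) → Fin (n + 2) → ℝ}
    (hΘ0 : ∀ u, Θ u 0 = 1 - ∑ i : Fin (n + 1), u (Fin.castSucc i))
    (hΘs : ∀ u (i : Fin (n + 1)), Θ u i.succ = u (Fin.castSucc i))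
    (hT : ∀ u k, T u k = 1 - u (Fin.last (n + 1)) * Θ u k)
    (hM : ∀ u k, M u k = (T u k) ^ (x:ℝ) * ∏ j : Fin (n + 1), (T u (k + j.succ)) ^ ((x:ℝ) + (((j:ℕ):ℝ) + 1) / ((n:ℝ) + 2) - 1))
    {u : Fin (n + 2) → ℝ}
    (hu : u ∈ {u : Fin (n + 2) → ℝ | (∀ i : Fin (n + 1), 0 < u (Fin.castSucc i)) ∧ ∑ i : Fin (n + 1), u (Fin.castSucc i) < 1 ∧ 0 < u (Fin.last (n + 1)) ∧ u (Fin.last (n + 1)) * (1 - ∑ i : Fin (n + 1), u (Fin.castSucc i)) < 1 ∧ ∀ i : Fin (n + 1), u (Fin.last (n + 1)) * u (Fin.castSucc i) < 1})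
    (i : Fin (n + 1)) (j : Fin (n + 2)) :
    (0 ≤ M u j ∧ M u j ≤ 1) ∧ M u j ≤ T u 0 * T u i.succ ∧ 1 - M u j ≤ x * u (Fin.last (n + 1)) ∧
      ∃ D, HasDerivAt (fun a => M (Function.update u (Fin.castSucc i) a) j) D (u (Fin.castSucc i)) ∧
        |D| ≤ ((n:ℝ) + 2) * (x * u (Fin.last (n + 1))) := by
  set y := u (Fin.last (n + 1)) with hy
  set e : Fin (n + 2) → ℝ := fun l =>
    Fin.cases (x:ℝ) (fun m : Fin (n + 1) => (x:ℝ) + (((m:ℕ):ℝ) + 1) / ((n:ℝ) + 2) - 1) l with he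
  have hem : ∀ l, 1 ≤ e l ∧ e l ≤ x := fun l => exponent_mem hx l
  have hTm := fun k => (CornerGraphGen.T_mem hΘ0 hΘs hT hu k)
  have hy0 : 0 < y := hu.2.2.1
  have hx' : (2:ℝ) ≤ x := by exact_mod_cast hx
  -- the factors of `M_j` along the slice
  set f : Fin (n + 2) → ℝ → ℝ := fun l a => (T (Function.update u (Fin.castSucc i) a) (j + l)) ^ e l
    with hf
  have hMf : ∀ a, M (Function.update u (Fin.castSucc i) a) j = ∏ l, f l a := fun a =>
    M_eq_prod x hM _ j
  have hfac : ∀ l, HasDerivAt (f l)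
      (-(y * Fin.cases (-1) (fun j' => if j' = i then 1 else 0) (j + l)) * e l * T u (j + l) ^ (e l - 1))
        (u (Fin.castSucc i)) ∧
      (0 ≤ T u (j + l) ^ e l ∧ T u (j + l) ^ e l ≤ 1) ∧
      |-(y * Fin.cases (-1) (fun j' => if j' = i then 1 else 0) (j + l)) * e l * T u (j + l) ^ (e l - 1)| ≤
        x * y := by
    intro l
    have hd := hasDerivAt_T hΘ0 hΘs hT u i (u (Fin.castSucc i)) (j + l)
    have h := hasDerivAt_rpow_factor (T := fun a => T (Function.update u (Fin.castSucc i) a) (j + l))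
      (emax := (x:ℝ)) (Y := y) hd (by simp only [Function.update_eq_self]; exact (hTm _).2.1)
      (by simp only [Function.update_eq_self]; exact (hTm _).2.2.le) (hem l).1 (hem l).2
      (abs_dT_le y hy0.le i (j + l))
    simp only [Function.update_eq_self] at h
    exact h
  have hval : ∀ l, f l (u (Fin.castSucc i)) = T u (j + l) ^ e l := fun l => by
    simp only [hf, Function.update_eq_self]
  have hM0 : M u j = ∏ l, T u (j + l) ^ e l := M_eq_prod x hM u j
  refine ⟨?_, ?_, ?_, ?_⟩
  · -- `M_j ∈ [0, 1]`
    rw [hM0]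
    exact ⟨Finset.prod_nonneg fun l _ => (hfac l).2.1.1,
      Finset.prod_le_one (fun l _ => (hfac l).2.1.1) fun l _ => (hfac l).2.1.2⟩
  · -- `M_j ≤ t₀ t_{i+1}`
    rw [hM0]
    calc ∏ l, T u (j + l) ^ e l ≤ ∏ l, T u (j + l) :=
          Finset.prod_le_prod (fun l _ => (hfac l).2.1.1) fun l _ =>
            CornerY.rpow_le_self_of_one_le (hTm _).2.1.le (hTm _).2.2.le (hem l).1
      _ = ∏ l, T u l := CornerField.prod_add_left (fun l => T u l) j
      _ = T u 0 * (T u i.succ * ∏ l ∈ (Finset.univ.erase (0 : Fin (n + 2))).erase i.succ, T u l) := by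
          rw [← Finset.mul_prod_erase Finset.univ _ (Finset.mem_univ (0 : Fin (n + 2))),
            ← Finset.mul_prod_erase _ _ (Finset.mem_erase.mpr ⟨Fin.succ_ne_zero i, Finset.mem_univ _⟩)]
      _ ≤ T u 0 * (T u i.succ * 1) := by
          gcongr
          · exact (hTm 0).2.1.le
          · exact (hTm _).2.1.le
          · exact Finset.prod_le_one (fun l _ => (hTm l).2.1.le) fun l _ => (hTm l).2.2.le
      _ = T u 0 * T u i.succ := by ring
  · -- `1 − M_j ≤ x y`
    rw [hM0]
    calc 1 - ∏ l, T u (j + l) ^ e l ≤ ∑ l, (1 - T u (j + l) ^ e l) :=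
          one_sub_prod_le_sum _ _ fun l _ => (hfac l).2.1
      _ ≤ ∑ l, x * (1 - T u (j + l)) := Finset.sum_le_sum fun l _ => by
          calc 1 - T u (j + l) ^ e l ≤ e l * (1 - T u (j + l)) :=
                CornerTheta1.one_sub_rpow_le (hTm _).2.1.le (hem l).1
            _ ≤ x * (1 - T u (j + l)) :=
                mul_le_mul_of_nonneg_right (hem l).2 (by linarith [(hTm (j + l)).2.2])
      _ = x * ∑ l, (1 - T u l) := by
          rw [← Finset.mul_sum, sum_add_left (fun l => 1 - T u l) j]
      _ = x * y := by
          congr 1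
          simp only [hT, sub_sub_cancel]
          rw [← Finset.mul_sum, CornerGraphGen.sum_theta hΘ0 hΘs u, mul_one]
  · -- the slice derivative
    obtain ⟨D, hD, hDb⟩ := exists_hasDerivAt_prod_le Finset.univ f _ (u (Fin.castSucc i)) (x * y)
      (fun l _ => (hfac l).1) (fun l _ => by rw [hval]; exact (hfac l).2.1) fun l _ => (hfac l).2.2
    refine ⟨D, hD.congr_of_eventuallyEq (Filter.Eventually.of_forall fun a => hMf a), ?_⟩
    rw [Finset.card_univ, Fintype.card_fin] at hDb
    push_cast at hDb
    exact hDb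

end CornerThetaDeriv

/-- **Registered helper sub-goal `cornerThetaDerivMonomialGen`** (serves `cornerThetaDerivBoundGen`):
the cyclic monomials `M_j` on the chart domain satisfy `M_j ∈ [0,1]`, `M_j ≤ t₀ t_{i+1}`,
`1 − M_j ≤ x y`, and have a `θ_i`-slice derivative bounded by `p x y` (`x ≥ 2`). [folklore] -/
theorem cornerThetaDerivMonomialGen : ∀ (n : ℕ) (x : ℚ), 2 ≤ x → ∀ (Θ T M : (Fin (n + 2) → ℝ) → Fin (n + 2) → ℝ),
    (∀ u, Θ u 0 = 1 - ∑ i : Fin (n + 1), u (Fin.castSucc i)) → (∀ u (i : Fin (n + 1)), Θ u i.succ = u (Fin.castSucc i)) →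
    (∀ u k, T u k = 1 - u (Fin.last (n + 1)) * Θ u k) →
    (∀ u k, M u k = (T u k) ^ (x:ℝ) * ∏ j : Fin (n + 1), (T u (k + j.succ)) ^ ((x:ℝ) + (((j:ℕ):ℝ) + 1) / ((n:ℝ) + 2) - 1)) →
    ∀ u ∈ {u : Fin (n + 2) → ℝ | (∀ i : Fin (n + 1), 0 < u (Fin.castSucc i)) ∧ ∑ i : Fin (n + 1), u (Fin.castSucc i) < 1 ∧ 0 < u (Fin.last (n + 1)) ∧ u (Fin.last (n + 1)) * (1 - ∑ i : Fin (n + 1), u (Fin.castSucc i)) < 1 ∧ ∀ i : Fin (n + 1), u (Fin.last (n + 1)) * u (Fin.castSucc i) < 1},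
    ∀ (i : Fin (n + 1)) (j : Fin (n + 2)),
    (0 ≤ M u j ∧ M u j ≤ 1) ∧ M u j ≤ T u 0 * T u i.succ ∧ 1 - M u j ≤ x * u (Fin.last (n + 1)) ∧
      ∃ D, HasDerivAt (fun a => M (Function.update u (Fin.castSucc i) a) j) D (u (Fin.castSucc i)) ∧
        |D| ≤ ((n:ℝ) + 2) * (x * u (Fin.last (n + 1))) :=
  fun _ _ hx _ _ _ hΘ0 hΘs hT hM _ hu i j => CornerThetaDeriv.M_facts hx hΘ0 hΘs hT hM hu i j

end Summit.KontsevichZagierPeriods.TerasomaMultiplication.MultiplicationAccessible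

end
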